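import Literature.NumberTheory.LFunctions.WeilFirstPrimeCertificateDataC
import HarnessLib

/-!
# First-prime Weil positivity, stage C: kernel check of the even scaled moments ν_96, ν_98, ν_100, ν_102, ν_104, ν_106

Part of `weilCert3C.check` (`WeilFirstPrimeCertificateDataC.lean`), evaluated by `decide +kernel` and kept in its own
file for kernel time and memory (each declaration is checked separately). Assembled in
`WeilFirstPrimeCertificateCCheck.lean`. Pure proof file; nothing is asserted.
-/

noncomputable section

namespace Literature.NumberTheory.LFunctions

set_option maxHeartbeats 0 in
/-- **Kernel check of the scaled moment `ν_{96}`** of the stage-C first-prime certificate. [folklore] -/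
theorem checkNuAt96_weilCert3C : weilCert3C.checkNuAt 96 = true := by
  decide +kernel

set_option maxHeartbeats 0 in
/-- **Kernel check of the scaled moment `ν_{98}`** of the stage-C first-prime certificate. [folklore] -/
theorem checkNuAt98_weilCert3C : weilCert3C.checkNuAt 98 = true := by
  decide +kernel

set_option maxHeartbeats 0 in
/-- **Kernel check of the scaled moment `ν_{100}`** of the stage-C first-prime certificate. [folklore] -/
theorem checkNuAt100_weilCert3C : weilCert3C.checkNuAt 100 = true := by
  decide +kernel

set_option maxHeartbeats 0 in
/-- **Kernel check of the scaled moment `ν_{102}`** of the stage-C first-prime certificate. [folklore] -/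
theorem checkNuAt102_weilCert3C : weilCert3C.checkNuAt 102 = true := by
  decide +kernel

set_option maxHeartbeats 0 in
/-- **Kernel check of the scaled moment `ν_{104}`** of the stage-C first-prime certificate. [folklore] -/
theorem checkNuAt104_weilCert3C : weilCert3C.checkNuAt 104 = true := by
  decide +kernel

set_option maxHeartbeats 0 in
/-- **Kernel check of the scaled moment `ν_{106}`** of the stage-C first-prime certificate. [folklore] -/
theorem checkNuAt106_weilCert3C : weilCert3C.checkNuAt 106 = true := by
  decide +kernel

end Literature.NumberTheory.LFunctions
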